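import Summits.QuantumFields.GaugeBoot.OneOverNContraction
import Summits.QuantumFields.GaugeBoot.CubePlaquettes
import HarnessLib

/-!
# The first-order `1/N` correction to gauge–string duality exists (gauge-boot, ADDENDUM 29 part B)

HONEST FRAMING (cell `pub-gaugeboot`, page 1 of every file): the venture produces certified bounds
on lattice expectations at stated coupling, gauge group, dimension and torus size; NOT a mass gap,
NOT a continuum limit, NOT a string tension; NOT Yang–Mills-summit-bearing (barriers
`FixedCouplingUltralocality`, `PerturbativeInvisibility`).  Strong-coupling `SO(N)` lattice gauge theory with free boundary
condition (S. Chatterjee, Comm. Math. Phys. **366** (2019); the `1/N` expansion is Chatterjee–Jafarov, arXiv:1604.04777);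
nothing about four-dimensional continuum Yang–Mills or a mass gap.

## Content

★★★ `tendsto_firstOrderCorrection` — for `d ≥ 2` there is `β₀(d) > 0` such that for every `|β| ≤ β₀`, every sequence of cubes
`Λ_N = [−M_N, M_N]^d` growing faster than `log N` (precisely: `M` monotone, `M_N → ∞`, `N (3/4)^{M_N} → 0`) and every loop sequence
`s`, the rescaled error of gauge–string duality CONVERGES:

  `N · (⟨W_{l₁}⋯W_{lₙ}⟩_{Λ_N,N,β}/Nⁿ − Σ_{X ∈ 𝒳(s)} w_β(X)) → ψ_β(s)`  as `N → ∞`,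

i.e. `⟨W_{l₁}⋯W_{lₙ}⟩/Nⁿ = Σ_X w_β(X) + ψ_β(s)/N + o(1/N)` — the first-order term of the `1/N` expansion exists.  Proof: `ψ_N = N(φ_N − T)`
satisfies the symmetrized master loop equation with the source `|s|φ_N + twistings + N⁻¹ mergers` (sibling
`OneOverNContraction.psi_equation`), whose values converge by Theorem 3.1; the difference `ψ_N − ψ_{N'}` therefore satisfies the
equation with a source that is eventually small on any finite set of loop sequences, is a priori bounded in the Catalan weight by
the quantitative duality of ADDENDUM 28 (depth `≳ log N` inside the cube), and the contraction with source
(`contraction_iterate`) makes it small: `(ψ_N(s))_N` is Cauchy.  The growth condition is necessary in general (finite-volume effects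
of order `(3/4)^{depth}` would otherwise dominate `1/N`).

Everything is `[folklore]` given the source and ADDENDA 28–29A; the statement itself is the first-order case of the `1/N` expansion
of Chatterjee–Jafarov (not in the tree).
-/

noncomputable section

open Filter Topology
open Literature.Probability.LatticeModels (Site box)
open Literature.MathematicalPhysics.QuantumLattice (ZdEdge ZdPlaquette)
open Literature.MathematicalPhysics.QuantumFieldTheory (latticeNorm)
open Literature.MathematicalPhysics.QuantumFieldTheory.Chatterjee2019LargeN
open Literature.MathematicalPhysics.QuantumFieldTheory.Chatterjee2019LargeN.CoeffCatalanBoundProof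

namespace Summit.QuantumFields.GaugeBoot

namespace StringDuality

variable {d : ℕ}

/-! ## Loop sequences sit inside cubes -/

/-- Every loop sequence has its vertices in some cube `[−r, r]^d`. [folklore] -/
theorem exists_vertices_mem_box (s : LoopSeq d) :
    ∃ r : ℕ, ∀ l ∈ s, ∀ a ∈ l, DEdge.src a ∈ box d r ∧ DEdge.tgt a ∈ box d r := by
  have hpt : ∀ u : Site d, ∃ r : ℕ, ∀ r' : ℕ, r ≤ r' → u ∈ box d r' := by
    intro u
    refine ⟨∑ i, (u i).natAbs, fun r' hr' => ?_⟩
    rw [mem_box_iff]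
    intro i
    have h1 : (((u i).natAbs : ℕ) : ℤ) ≤ ((∑ j, (u j).natAbs : ℕ) : ℤ) := by
      exact_mod_cast Finset.single_le_sum (fun j _ => Nat.zero_le (u j).natAbs) (Finset.mem_univ i)
    rw [Int.natCast_natAbs] at h1
    have h2 : ((∑ j, (u j).natAbs : ℕ) : ℤ) ≤ r' := by exact_mod_cast hr'
    constructor <;> linarith [neg_abs_le (u i), le_abs_self (u i)]
  -- all vertices: a finite list
  have hfin : ∀ L : List (Site d), ∃ r : ℕ, ∀ u ∈ L, ∀ r' : ℕ, r ≤ r' → u ∈ box d r' := by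
    intro L
    induction L with
    | nil => exact ⟨0, fun u hu => by simp at hu⟩
    | cons u L ih =>
      obtain ⟨r₁, h₁⟩ := hpt u
      obtain ⟨r₂, h₂⟩ := ih
      refine ⟨max r₁ r₂, fun v hv r' hr' => ?_⟩
      rw [List.mem_cons] at hv
      rcases hv with rfl | hv
      · exact h₁ r' ((le_max_left _ _).trans hr')
      · exact h₂ v hv r' ((le_max_right _ _).trans hr')
  obtain ⟨r, hr⟩ := hfin ((s.flatMap id).flatMap fun a => [DEdge.src a, DEdge.tgt a])
  refine ⟨r, fun l hl a ha => ⟨hr _ ?_ r le_rfl, hr _ ?_ r le_rfl⟩⟩ <;>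
    simp only [List.mem_flatMap, id, List.mem_cons, List.not_mem_nil, or_false] <;>
    exact ⟨a, ⟨l, hl, ha⟩, by simp⟩

/-- If the vertices of `s` lie in `[−r, r]^d` and `r + n ≤ M`, the Euclidean `n`-neighbourhood of the vertices lies in
`[−M, M]^d`. [folklore] -/
theorem ball_of_vertices_mem_box {r n M : ℕ} (hM : r + n ≤ M) {s : LoopSeq d}
    (hs : ∀ l ∈ s, ∀ a ∈ l, DEdge.src a ∈ box d r ∧ DEdge.tgt a ∈ box d r) :
    ∀ l ∈ s, ∀ a ∈ l, ∀ v : Site d,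
      latticeNorm (v - DEdge.src a) ≤ (n : ℕ) ∨ latticeNorm (v - DEdge.tgt a) ≤ (n : ℕ) → v ∈ box d M := by
  intro l hl a ha v hv
  obtain ⟨u, hu, hvu⟩ : ∃ u : Site d, u ∈ box d r ∧ latticeNorm (v - u) ≤ n := by
    rcases hv with hv | hv
    · exact ⟨_, (hs l hl a ha).1, hv⟩
    · exact ⟨_, (hs l hl a ha).2, hv⟩
  rw [mem_box_iff] at hu ⊢
  intro k
  have h1 : |(((v - u) k : ℤ) : ℝ)| ≤ n := (abs_apply_le_latticeNorm (v - u) k).trans hvu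
  have h2 : |(v k : ℤ) - u k| ≤ n := by rw [Pi.sub_apply] at h1; exact_mod_cast h1
  have h3 := hu k
  have hM' : (r : ℤ) + n ≤ M := by exact_mod_cast hM
  rw [abs_le] at h2
  constructor <;> linarith [h2.1, h2.2, h3.1, h3.2]

/-! ## The first-order correction -/

/-- From `∀ᶠ N, P N` on `ℕ` to the diagonal product filter. [folklore] -/
theorem eventually_prod_of_eventually {P : ℕ → Prop} (h : ∀ᶠ N in atTop, P N) :
    ∀ᶠ q : ℕ × ℕ in atTop, P q.1 ∧ P q.2 := by
  obtain ⟨a, ha⟩ := eventually_atTop.mp h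
  exact eventually_atTop.mpr ⟨(a, a), fun q hq => ⟨ha _ (Prod.mk_le_mk.mp hq).1, ha _ (Prod.mk_le_mk.mp hq).2⟩⟩

/-- A convergent real sequence is Cauchy along the product filter: eventually `|u N − u N'| ≤ ε`. [folklore] -/
theorem eventually_abs_sub_le_of_tendsto {u : ℕ → ℝ} {L : ℝ} (h : Tendsto u atTop (𝓝 L)) {ε : ℝ} (hε : 0 < ε) :
    ∀ᶠ q : ℕ × ℕ in atTop, |u q.1 - u q.2| ≤ ε := by
  have h1 : ∀ᶠ N in atTop, |u N - L| < ε / 2 := by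
    have := (Metric.tendsto_nhds.mp h) (ε / 2) (by positivity)
    simpa only [Real.dist_eq] using this
  filter_upwards [eventually_prod_of_eventually h1] with q hq
  have := abs_sub_abs_le_abs_sub (u q.1 - L) (u q.2 - L)
  calc |u q.1 - u q.2| = |(u q.1 - L) - (u q.2 - L)| := by ring_nf
    _ ≤ |u q.1 - L| + |u q.2 - L| := abs_sub _ _
    _ ≤ ε := by linarith [hq.1, hq.2]

variable (d)

/-- ★★★ **The first-order `1/N` correction to gauge–string duality exists.**  There is `β₀(d) > 0` such that for every
monotone `M : ℕ → ℕ` with `M_N → ∞` and `N (3/4)^{M_N} → 0`, every `|β| ≤ β₀` and every genuine loop sequence `s`, the sequence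
`N (φ_{[−M_N,M_N]^d,N,β}(s) − Σ_{X ∈ 𝒳(s)} w_β(X))` converges.
[cite: Chatterjee2019LargeN, Theorem 3.1, Theorem 3.6, Theorem 9.9 (the ingredients); the statement is the first-order case of the 1/N expansion of Chatterjee–Jafarov] -/
theorem tendsto_firstOrderCorrection (hd : 2 ≤ d) :
    ∃ β₀ : ℝ, 0 < β₀ ∧ ∀ M : ℕ → ℕ, Monotone M → Tendsto M atTop atTop →
      Tendsto (fun N : ℕ => (N : ℝ) * (3 / 4 : ℝ) ^ M N) atTop (𝓝 0) →
        ∀ β : ℝ, |β| ≤ β₀ → ∀ s : LoopSeq d, IsLoopSeq s →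
          ∃ ψ : ℝ, Tendsto (fun N : ℕ => (N : ℝ) *
            (phi N β (box d (M N)) s - ∑' X : Trajectory s, X.weight β)) atTop (𝓝 ψ) := by
  -- constants
  obtain ⟨β₁, hβ₁, K₁, hK₁, HR⟩ := abs_phi_sub_trajectorySum_le d hd
  obtain ⟨β₃, hβ₃, H3⟩ := gaugeStringDuality_holds d hd
  set K : ℝ := max K₁ 4 with hKdef
  have hK4 : 4 ≤ K := le_max_right _ _
  have hK1K : K₁ ≤ K := le_max_left _ _
  have hK0 : 0 < K := by linarith
  set P : ℝ := ((2 * (d - 1) : ℕ) : ℝ) with hPdef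
  have hP0 : 0 ≤ P := Nat.cast_nonneg _
  have hP : P ≤ 2 * ((d : ℝ) + 1) := by
    have h : (2 * (d - 1) : ℕ) ≤ 2 * (d + 1) := by omega
    rw [hPdef]; exact_mod_cast h
  have hβT : (0 : ℝ) < 1 / (2 * bigK d ^ 5) := by have := one_le_bigK d; positivity
  refine ⟨min (min β₁ β₃) (min (1 / (2 * bigK d ^ 5)) (1 / (4096 * ((d : ℝ) + 1) * K ^ 4))),
    lt_min (lt_min hβ₁ hβ₃) (lt_min hβT (by positivity)), fun M hMmono hM hgrowth β hβ s hs => ?_⟩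
  have hb1 : |β| ≤ β₁ := hβ.trans ((min_le_left _ _).trans (min_le_left _ _))
  have hb3 : |β| ≤ β₃ := hβ.trans ((min_le_left _ _).trans (min_le_right _ _))
  have hbT : |β| ≤ 1 / (2 * bigK d ^ 5) := hβ.trans ((min_le_right _ _).trans (min_le_left _ _))
  have hb4 : |β| ≤ 1 / (4096 * ((d : ℝ) + 1) * K ^ 4) := hβ.trans ((min_le_right _ _).trans (min_le_right _ _))
  -- the contraction constant
  have hθ : 2 / K + |β| * (2 * P * 256 * K ^ 4) ≤ 3 / 4 := by
    have h1 : 2 / K ≤ 1 / 2 := by rw [div_le_iff₀ hK0]; linarith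
    have h2 : |β| * (2 * P * 256 * K ^ 4) ≤ 1 / 4 := by
      calc |β| * (2 * P * 256 * K ^ 4)
          ≤ (1 / (4096 * ((d : ℝ) + 1) * K ^ 4)) * (2 * (2 * ((d : ℝ) + 1)) * 256 * K ^ 4) := by
            apply mul_le_mul hb4 _ (by positivity) (by positivity); gcongr
        _ = 1 / 4 := by field_simp; ring
    linarith
  obtain ⟨θ, hθdef⟩ : ∃ θ : ℝ, θ = 2 / K + |β| * (2 * P * 256 * K ^ 4) := ⟨_, rfl⟩
  have hθ0 : 0 ≤ θ := by rw [hθdef]; positivity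
  have hθ1 : θ ≤ 3 / 4 := by rw [hθdef]; exact hθ
  -- notation
  set T : LoopSeq d → ℝ := fun t => ∑' X : Trajectory t, X.weight β with hT
  set φ : ℕ → LoopSeq d → ℝ := fun N t => phi N β (box d (M N)) t with hφ
  set ψ : ℕ → LoopSeq d → ℝ := fun N t => (N : ℝ) * (φ N t - T t) with hψ
  set Φ : LoopSeq d → ℝ := fun t => K ^ t.index * catProd t with hΦ
  have hΦpos : ∀ t, 0 < Φ t := fun t => mul_pos (pow_pos hK0 _) (lt_of_lt_of_le one_pos (one_le_catProd t))
  -- the source of the equation of `ψ_N`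
  set SRC : ℕ → LoopSeq d → ℝ := fun N t => (t.len : ℝ) * φ N t
      + ((∑ o : SameIdx t, φ N (t.negTwistAt o)) - ∑ o : InvIdx t, φ N (t.posTwistAt o))
      + (1 / (N : ℝ)) * ((∑ o : MergeIdx t, φ N (t.negMergeAt o)) - ∑ o : MergeIdx t, φ N (t.posMergeAt o)) with hSRC
  -- the cubes form an exhaustion, so every `φ_N(t)` converges to `T(t)` and the source converges
  have hexh : IsExhaustion fun N => box d (M N) := by
    refine ⟨fun m n hmn => ?_, fun x => ?_⟩
    · exact isExhaustion_box.1 (hMmono hmn)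
    · obtain ⟨n, hn⟩ := isExhaustion_box (d := d) |>.2 x
      obtain ⟨N, hN⟩ := (tendsto_atTop.mp hM n).exists
      exact ⟨N, isExhaustion_box.1 hN hn⟩
  have hφT : ∀ t, IsLoopSeq t → Tendsto (fun N => φ N t) atTop (𝓝 (T t)) := fun t ht => (H3 _ hexh β hb3 t ht).2
  have hSRCconv : ∀ t, IsLoopSeq t → ∃ L : ℝ, Tendsto (fun N => SRC N t) atTop (𝓝 L) := by
    intro t ht
    refine ⟨(t.len : ℝ) * T t + ((∑ o : SameIdx t, T (t.negTwistAt o)) - ∑ o : InvIdx t, T (t.posTwistAt o))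
      + 0 * ((∑ o : MergeIdx t, T (t.negMergeAt o)) - ∑ o : MergeIdx t, T (t.posMergeAt o)), ?_⟩
    refine ((tendsto_const_nhds.mul (hφT t ht)).add ((tendsto_finsetSum _ fun o _ => hφT _ (ht.negTwistAt o)).sub
      (tendsto_finsetSum _ fun o _ => hφT _ (ht.posTwistAt o)))).add ?_
    refine Tendsto.mul ?_ ((tendsto_finsetSum _ fun o _ => hφT _ (ht.negMergeAt o)).sub
      (tendsto_finsetSum _ fun o _ => hφT _ (ht.posMergeAt o)))
    exact tendsto_one_div_atTop_nhds_zero_nat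
  -- the vertices of `s` lie in a cube
  obtain ⟨r, hr⟩ := exists_vertices_mem_box s
  -- Cauchy
  have hcauchy : CauchySeq fun N => ψ N s := by
    rw [Metric.cauchySeq_iff]
    intro ε hε
    -- depth `n` and source tolerance `η`
    obtain ⟨n, hn⟩ : ∃ n : ℕ, 42 * θ ^ n * Φ s < ε / 2 := by
      have h := ((tendsto_pow_atTop_nhds_zero_of_lt_one hθ0 (by linarith)).const_mul 42).mul_const (Φ s)
      rw [mul_zero, zero_mul] at h
      exact (h.eventually (gt_mem_nhds (by positivity))).exists
    set η : ℝ := ε / (16 * Φ s) with hη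
    have hΦs0 : Φ s ≠ 0 := (hΦpos s).ne'
    have hη0 : 0 < η := by rw [hη]; exact div_pos hε (mul_pos (by norm_num) (hΦpos s))
    have hη' : 4 * η * Φ s = ε / 4 := by rw [hη]; field_simp; ring
    -- the source-tolerance predicate on descendants, by recursion on the generation
    let Src : ℕ × ℕ → ℕ → LoopSeq d → Prop := fun q =>
      Nat.rec (motive := fun _ => LoopSeq d → Prop) (fun _ => True) fun m G t =>
        (IsLoopSeq t → t ≠ [] → |SRC q.1 t - SRC q.2 t| ≤ η * t.len * Φ t) ∧
          (∀ o : SameIdx t, G (t.posSplitAt o)) ∧ (∀ o : InvIdx t, G (t.negSplitAt o)) ∧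
          (∀ o : DeformIdx t, G (t.posDeformAt o)) ∧ (∀ o : DeformIdx t, G (t.negDeformAt o))
    have hSrc_ev : ∀ (m : ℕ) (t : LoopSeq d), ∀ᶠ q : ℕ × ℕ in atTop, Src q m t := by
      intro m
      induction m with
      | zero => intro t; exact Eventually.of_forall fun q => trivial
      | succ m ih =>
        intro t
        have h0 : ∀ᶠ q : ℕ × ℕ in atTop, IsLoopSeq t → t ≠ [] → |SRC q.1 t - SRC q.2 t| ≤ η * t.len * Φ t := by
          by_cases ht : IsLoopSeq t
          · by_cases htne : t = []
            · exact Eventually.of_forall fun q _ h => (h htne).elim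
            · obtain ⟨L, hL⟩ := hSRCconv t ht
              have hpos : 0 < η * t.len * Φ t := by
                have : (0 : ℝ) < t.len := by exact_mod_cast LoopSeq.len_pos ht htne
                exact mul_pos (mul_pos hη0 this) (hΦpos t)
              filter_upwards [eventually_abs_sub_le_of_tendsto hL hpos] with q hq _ _
              exact hq
          · exact Eventually.of_forall fun q h => (ht h).elim
        have h1 : ∀ᶠ q : ℕ × ℕ in atTop, ∀ o : SameIdx t, Src q m (t.posSplitAt o) := eventually_all.mpr fun o => ih _
        have h2 : ∀ᶠ q : ℕ × ℕ in atTop, ∀ o : InvIdx t, Src q m (t.negSplitAt o) := eventually_all.mpr fun o => ih _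
        have h3 : ∀ᶠ q : ℕ × ℕ in atTop, ∀ o : DeformIdx t, Src q m (t.posDeformAt o) := eventually_all.mpr fun o => ih _
        have h4 : ∀ᶠ q : ℕ × ℕ in atTop, ∀ o : DeformIdx t, Src q m (t.negDeformAt o) := eventually_all.mpr fun o => ih _
        filter_upwards [h0, h1, h2, h3, h4] with q a b c e f
        exact ⟨a, b, c, e, f⟩
    -- conditions on a single `N`: `N ≥ 2`, `M_N ≥ r + n + 1`, `3N(3/4)^{M_N − r − n} ≤ 1`
    have hN_ev : ∀ᶠ N : ℕ in atTop, 2 ≤ N ∧ r + n + 1 ≤ M N ∧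
        3 * (N : ℝ) * (3 / 4 : ℝ) ^ (M N - (r + n)) ≤ 1 := by
      have e1 : ∀ᶠ N : ℕ in atTop, 2 ≤ N := eventually_ge_atTop 2
      have e2 : ∀ᶠ N : ℕ in atTop, r + n + 1 ≤ M N := (tendsto_atTop.mp hM) _
      have e3 : ∀ᶠ N : ℕ in atTop, 3 * (N : ℝ) * (3 / 4 : ℝ) ^ (M N - (r + n)) ≤ 1 := by
        have h := hgrowth.const_mul (3 * (4 / 3 : ℝ) ^ (r + n))
        rw [mul_zero] at h
        filter_upwards [h.eventually (ge_mem_nhds (by norm_num : (0 : ℝ) < 1)), e2] with N hN hMN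
        have hsplit : (3 / 4 : ℝ) ^ M N = (3 / 4 : ℝ) ^ (M N - (r + n)) * (3 / 4 : ℝ) ^ (r + n) := by
          rw [← pow_add]; congr 1; omega
        have : 3 * (4 / 3 : ℝ) ^ (r + n) * ((N : ℝ) * (3 / 4 : ℝ) ^ M N) =
            3 * (N : ℝ) * (3 / 4 : ℝ) ^ (M N - (r + n)) := by
          rw [hsplit]
          have h43 : (4 / 3 : ℝ) ^ (r + n) * (3 / 4 : ℝ) ^ (r + n) = 1 := by
            rw [← mul_pow]; norm_num
          calc 3 * (4 / 3 : ℝ) ^ (r + n) * ((N : ℝ) * ((3 / 4 : ℝ) ^ (M N - (r + n)) * (3 / 4 : ℝ) ^ (r + n)))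
              = 3 * (N : ℝ) * (3 / 4 : ℝ) ^ (M N - (r + n)) * ((4 / 3 : ℝ) ^ (r + n) * (3 / 4 : ℝ) ^ (r + n)) := by ring
            _ = _ := by rw [h43, mul_one]
        rw [this] at hN
        exact hN
      filter_upwards [e1, e2, e3] with N a b c
      exact ⟨a, b, c⟩
    obtain ⟨q₀, hq₀⟩ := eventually_atTop.mp ((eventually_prod_of_eventually hN_ev).and (hSrc_ev n s))
    refine ⟨max q₀.1 q₀.2, fun N hN N' hN' => ?_⟩
    have hq : q₀ ≤ (N, N') := Prod.mk_le_mk.mpr ⟨(le_max_left _ _).trans hN, (le_max_right _ _).trans hN'⟩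
    have hq' := hq₀ (N, N') hq
    dsimp only at hq'
    obtain ⟨⟨⟨hN2, hMN, hdepN⟩, ⟨hN2', hMN', hdepN'⟩⟩, hsrc⟩ := hq'
    -- the depth grading for the difference `Δ = ψ_N − ψ_{N'}`
    set cN : ℕ := M N - (r + n) with hcN
    set cN' : ℕ := M N' - (r + n) with hcN'
    let G : ℕ → LoopSeq d → Prop := fun m t =>
      (∀ l ∈ t, ∀ a ∈ l, ∀ v : Site d,
          latticeNorm (v - DEdge.src a) ≤ ((m + cN : ℕ) : ℝ) ∨ latticeNorm (v - DEdge.tgt a) ≤ ((m + cN : ℕ) : ℝ) →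
            v ∈ box d (M N)) ∧
        (∀ l ∈ t, ∀ a ∈ l, ∀ v : Site d,
          latticeNorm (v - DEdge.src a) ≤ ((m + cN' : ℕ) : ℝ) ∨ latticeNorm (v - DEdge.tgt a) ≤ ((m + cN' : ℕ) : ℝ) →
            v ∈ box d (M N')) ∧
        Src (N, N') m t
    set Δ : LoopSeq d → ℝ := fun t => ψ N t - ψ N' t with hΔ
    -- (i) `Δ(∅) = 0`
    have hΔ0 : Δ [] = 0 := by
      simp only [hΔ, hψ, hφ, hT, phi_nil, trajectorySum_nil, sub_self, mul_zero]
    -- (ii) leaves: the a priori bound from the quantitative duality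
    have hψb : ∀ (N₁ : ℕ) (c : ℕ), 2 ≤ N₁ → 3 * (N₁ : ℝ) * (3 / 4 : ℝ) ^ c ≤ 1 → ∀ t : LoopSeq d, IsLoopSeq t →
        (∀ l ∈ t, ∀ a ∈ l, ∀ v : Site d,
          latticeNorm (v - DEdge.src a) ≤ (c : ℕ) ∨ latticeNorm (v - DEdge.tgt a) ≤ (c : ℕ) → v ∈ box d (M N₁)) →
        |ψ N₁ t| ≤ 21 * Φ t := by
      intro N₁ c hN₁ hdep t ht hball
      have hne : (box d (M N₁)).Nonempty := Finset.card_pos.mp (card_box_pos (M N₁))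
      have h := HR (box d (M N₁)) hne N₁ hN₁ β hb1
        (fun m u => ∀ l ∈ u, ∀ a ∈ l, ∀ v : Site d,
          latticeNorm (v - DEdge.src a) ≤ (m : ℕ) ∨ latticeNorm (v - DEdge.tgt a) ≤ (m : ℕ) → v ∈ box d (M N₁))
        (fun m u hu => ball_compatible (box d (M N₁)) m u hu) c t ht hball
      have hN₁0 : (0 : ℝ) < N₁ := by exact_mod_cast (by omega : 0 < N₁)
      have hKpow : K₁ ^ t.index * catProd t ≤ Φ t :=
        mul_le_mul_of_nonneg_right (pow_le_pow_left₀ (by linarith) hK1K _) (catProd_nonneg _)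
      calc |ψ N₁ t| = (N₁ : ℝ) * |φ N₁ t - T t| := by rw [hψ]; simp only; rw [abs_mul, abs_of_pos hN₁0]
        _ ≤ (N₁ : ℝ) * ((3 * (3 / 4 : ℝ) ^ c + 20 / N₁) * (K₁ ^ t.index * catProd t)) :=
            mul_le_mul_of_nonneg_left h hN₁0.le
        _ = (3 * (N₁ : ℝ) * (3 / 4 : ℝ) ^ c + 20) * (K₁ ^ t.index * catProd t) := by field_simp
        _ ≤ 21 * Φ t := by
            refine mul_le_mul (by linarith) hKpow (mul_nonneg (pow_nonneg (by linarith) _) (catProd_nonneg _))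
              (by norm_num)
    have hleaf : ∀ t : LoopSeq d, IsLoopSeq t → G 0 t → |Δ t| ≤ 42 * (K ^ t.index * catProd t) := by
      intro t ht hg
      obtain ⟨hb, hb', -⟩ := hg
      simp only [zero_add] at hb hb'
      have h1 := hψb N cN hN2 hdepN t ht hb
      have h2 := hψb N' cN' hN2' hdepN' t ht hb'
      calc |Δ t| ≤ |ψ N t| + |ψ N' t| := abs_sub _ _
        _ ≤ 42 * (K ^ t.index * catProd t) := by rw [hΦ] at h1 h2; linarith
    -- (iii) inner nodes: the sourced equation and the compatibility of the grading
    have hnode : ∀ (m : ℕ) (t : LoopSeq d), G (m + 1) t →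
        (IsLoopSeq t → t ≠ [] →
          |(t.len : ℝ) * Δ t -
            ((∑ o : InvIdx t, Δ (t.negSplitAt o)) - (∑ o : SameIdx t, Δ (t.posSplitAt o))
              + β * (∑ o : DeformIdx t, Δ (t.negDeformAt o)) - β * (∑ o : DeformIdx t, Δ (t.posDeformAt o)))| ≤
            η * t.len * (K ^ t.index * catProd t)) ∧
        (∀ o : SameIdx t, G m (t.posSplitAt o)) ∧ (∀ o : InvIdx t, G m (t.negSplitAt o)) ∧
        (∀ o : DeformIdx t, G m (t.posDeformAt o)) ∧ (∀ o : DeformIdx t, G m (t.negDeformAt o)) := by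
      intro m t hg
      obtain ⟨hb, hb', hsrc'⟩ := hg
      obtain ⟨hs0, hS, hI, hDp, hDn⟩ := hsrc'
      have hc := ball_compatible (box d (M N)) (m + cN) t (by simpa only [Nat.add_right_comm] using hb)
      have hc' := ball_compatible (box d (M N')) (m + cN') t (by simpa only [Nat.add_right_comm] using hb')
      refine ⟨fun ht htne => ?_, fun o => ⟨hc.2.1 o, hc'.2.1 o, hS o⟩, fun o => ⟨hc.2.2.1 o, hc'.2.2.1 o, hI o⟩,
        fun o => ⟨hc.2.2.2.1 o, hc'.2.2.2.1 o, hDp o⟩, fun o => ⟨hc.2.2.2.2 o, hc'.2.2.2.2 o, hDn o⟩⟩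
      -- the two exact equations
      have hne1 : (box d (M N)).Nonempty := Finset.card_pos.mp (card_box_pos (M N))
      have hne2 : (box d (M N')).Nonempty := Finset.card_pos.mp (card_box_pos (M N'))
      have e1 := psi_equation hd hne1 hN2 hbT ht htne hc.1
      have e2 := psi_equation hd hne2 hN2' hbT ht htne hc'.1
      simp only at e1 e2
      have hdiff : (t.len : ℝ) * Δ t -
          ((∑ o : InvIdx t, Δ (t.negSplitAt o)) - (∑ o : SameIdx t, Δ (t.posSplitAt o))
            + β * (∑ o : DeformIdx t, Δ (t.negDeformAt o)) - β * (∑ o : DeformIdx t, Δ (t.posDeformAt o))) =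
          SRC N t - SRC N' t := by
        rw [hSRC]; simp only
        rw [← e1, ← e2, hΔ, hψ, hφ, hT]
        simp only [Finset.sum_sub_distrib]
        ring
      rw [hdiff]
      have := hs0 ht htne
      rwa [hΦ] at this
    -- (iv) the target is at depth `n`
    have hGn : G n s := by
      refine ⟨ball_of_vertices_mem_box (by omega) hr, ball_of_vertices_mem_box (by omega) hr, hsrc⟩
    -- (v) contract
    have hmain := contraction_iterate (β := β) hK4 (by norm_num : (0 : ℝ) ≤ 42) hη0.le (by rw [← hPdef]; exact hθ) Δ hΔ0 G
      hleaf hnode n s hs hGn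
    rw [← hPdef, ← hθdef] at hmain
    rw [Real.dist_eq]
    calc |ψ N s - ψ N' s| = |Δ s| := rfl
      _ ≤ (42 * θ ^ n + 4 * η) * (K ^ s.index * catProd s) := hmain
      _ = 42 * θ ^ n * Φ s + 4 * η * Φ s := by rw [hΦ]; ring
      _ < ε / 2 + ε / 4 := by linarith
      _ < ε := by linarith
  obtain ⟨ψ₀, hψ₀⟩ := cauchySeq_tendsto_of_complete hcauchy
  exact ⟨ψ₀, hψ₀⟩

end StringDuality

end Summit.QuantumFields.GaugeBoot

end
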